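import Literature.NumberTheory.Automorphic.RankinSelbergLocalUniqueness
import HarnessLib

/-!
# The unramified Rankin–Selberg `L`-factor: the zero measure and the rank `m = 0`

Topic `NumberTheory/Automorphic`; namespace `Literature.NumberTheory.Automorphic`. Companion to
`RankinSelbergLocal`, whose named fact `hasRSLFactor_of_isSatakeParameter` records the
**unramified computation** of the local Rankin–Selberg `L`-factor of Jacquet–Piatetski-Shapiro–
Shalika: for irreducible admissible generic unramified `π` of `GL_n(F)` and `π'` of `GL_m(F)`,
`m < n`, with Satake parameters `{α_i}`, `{β_j}`,

`L(s, π × π') = det(1 - q^{-s} A_π ⊗ A_{π'})⁻¹ = ∏_{i,j} (1 - α_i β_j q^{-s})⁻¹`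

as the normalised generator of the fractional ideal spanned by ALL zeta integrals
`Ψ(s; W, W')`, `W ∈ 𝒲(π, ψ)`, `W' ∈ 𝒲(π', ψ⁻¹)` (Getz–Hahn 2024, Thm. 11.6.2, printed p. 222,
"More is true (see [JPSS83])", after Thm. 11.6.1 = the spherical computation
`Ψ(s; W°, W'°) = det(…)⁻¹`; Cogdell 2004, Thm. 3.3; Jacquet–Shalika 1981, §2).

## The measure hypothesis (why a corrected statement)

In `RankinSelbergLocal` the hypotheses making `ν` *the* invariant measure on `GL_m(F) ⧸ U_m` —
`[BorelSpace (GL_m ⧸ U_m)]`, `[SMulInvariantMeasure GL_m (GL_m ⧸ U_m) ν]`,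
`[IsFiniteMeasureOnCompacts ν]`, `[ν.IsOpenPosMeasure]` — are section instance `variable`s; the
named fact being a `def … : Prop`, which abstracts only the variables its body mentions, NONE of
them is an argument of `hasRSLFactor_of_isSatakeParameter` (its signature ends
`… (ψ : AddChar F Circle) [MeasurableSpace (GL (Fin m) F ⧸ _)] (ν : Measure _) : Prop`; recorded
for the whole file in `RankinSelbergLocalUniqueness`, with the closed counterexample to
`existsUnique_hasRSGamma` in `RankinSelbergLocalGammaCounterexample`). As elaborated the fact
thus quantifies over EVERY measure `ν`, and at `ν = 0` — where all zeta integrals vanish and no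
`P` satisfies `HasRSLFactor` (`not_hasRSLFactor_zero_measure`) — it asserts that no pair
`(π, π')` meets its hypotheses (`hasRSLFactor_of_isSatakeParameter_zero_measure_iff` below), which
is absurd (unramified principal series exist). The intended theorem binds the four hypotheses
INSIDE the statement:
`∀ [BorelSpace (GL_m ⧸ U_m)] [SMulInvariantMeasure GL_m (GL_m ⧸ U_m) ν] [IsFiniteMeasureOnCompacts ν]
[ν.IsOpenPosMeasure] [π.IsIrreducible] [π'.IsIrreducible], π.IsAdmissible → … →
HasRSLFactor hmn π π' ψ ν (satakePairPolynomial α β)` (to be recorded as a named fact by the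
operator; a proving seat may not mint it, D-0026). This file proves what is provable now about
the predicate `HasRSLFactor` in the degenerate rank `m = 0` admitted by `m < n` — these theorems
hold for every `ν` giving the point `GL_0 ⧸ U_0` finite positive mass and therefore serve the
corrected fact unchanged:

* `hasRSLFactor_one_of_rank_zero`, `hasRSLFactor_satakePairPolynomial_of_rank_zero`: for `m = 0`
  (`GL_0(F) ⧸ U_0` is a point of finite positive mass) and smooth generic `π`, `π'`,
  `HasRSLFactor` holds with `P = 1 = satakePairPolynomial α ∅`: every
  `Ψ(s; W_v, W'_{v'}) = ν(pt) Λ(v) Λ'(v')` is constant in `s` and `1` is a multiple of one of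
  them (the sources take `m ≥ 1`; the extra case is harmless and true).

What is NOT here: the case `m ≥ 1`, i.e. the theorem itself — the JPSS local theory (Thm. 2.7:
convergence and rationality of all `Ψ`; §§8–9: `L`-factors of induced pairs), the classification
of generic unramified representations, the Iwasawa unfolding of `Ψ(s; W°, W'°)` and
Casselman–Shalika's `W°(1) ≠ 0`. The torus-sum core of the spherical computation
(Getz–Hahn Thm. 11.6.1) for `m ≤ n` is proved in `RankinSelbergUnramifiedTorus`.

## References

* J. R. Getz, H. Hahn, *An Introduction to Automorphic Representations*, GTM 300 (2024),
  Prop. 11.5.1, (11.14), Thm. 11.6.1, Thm. 11.6.2 (printed pp. 219–222) [GetzHahn2024].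
* J. W. Cogdell, *Analytic theory of `L`-functions for `GL_n`*, in: An Introduction to the
  Langlands Program (2004), §3.1, Thm. 3.1, Thm. 3.3 [CogdellAnalyticTheory2004].
* H. Jacquet, J. A. Shalika, *On Euler products and the classification of automorphic
  representations I*, Amer. J. Math. 103 (1981), 499–558, §2 [JacquetShalikaAJM1981].
-/

set_option autoImplicit false

open scoped NNReal
open Matrix MeasureTheory Polynomial ValuativeRel
  Literature.NumberTheory.GaloisRepresentations.IsNonarchimedeanLocalField

noncomputable section

namespace Literature.NumberTheory.Automorphic

/-! ### The uncorrected statement at the zero measure -/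

section Statement

variable {F : Type*} [Field F] [ValuativeRel F] [TopologicalSpace F]
  [IsNonarchimedeanLocalField F] {n m : ℕ}
  {V : Type*} [AddCommGroup V] [Module ℂ V] {V' : Type*} [AddCommGroup V'] [Module ℂ V']
  (hmn : m < n) (π : Representation ℂ (GL (Fin n) F) V) (π' : Representation ℂ (GL (Fin m) F) V')
  (ψ : AddChar F Circle) [MeasurableSpace (GL (Fin m) F ⧸ upperUnitriangular (Fin m) F)]
  (ν : Measure (GL (Fin m) F ⧸ upperUnitriangular (Fin m) F))

/-- What the uncorrected named fact `hasRSLFactor_of_isSatakeParameter` says at `ν = 0`: that no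
pair `(π, π')` satisfies its hypotheses (irreducible, admissible, generic, `ψ` non-trivial
continuous, Satake parameters w.r.t. a uniformiser) — because no `P` at all is an `L`-polynomial
for the zero measure (`not_hasRSLFactor_zero_measure` of `RankinSelbergLocalUniqueness`).
[folklore] -/
theorem hasRSLFactor_of_isSatakeParameter_zero_measure_iff :
    hasRSLFactor_of_isSatakeParameter hmn π π' ψ
        (0 : Measure (GL (Fin m) F ⧸ upperUnitriangular (Fin m) F)) ↔
      ∀ [π.IsIrreducible] [π'.IsIrreducible], π.IsAdmissible → π'.IsAdmissible →
        IsGeneric π ψ → IsGeneric π' ψ⁻¹ → ψ.IsContinuousNontrivial →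
        ∀ {ϖ : Fˣ}, (valuation F).IsUniformizer (ϖ : F) →
        ∀ {α β : Multiset ℂ}, IsSatakeParameter π ϖ α → IsSatakeParameter π' ϖ β → False := by
  constructor
  · intro h _ _ hπ hπ' hg hg' hψ ϖ hϖ α β hα hβ
    exact not_hasRSLFactor_zero_measure (h hπ hπ' hg hg' hψ hϖ hα hβ)
  · intro h _ _ hπ hπ' hg hg' hψ ϖ hϖ α β hα hβ
    exact (h hπ hπ' hg hg' hψ hϖ hα hβ).elim

end Statement

/-! ### Rank `m = 0` -/

section RankZero

variable {F : Type*} [Field F] [ValuativeRel F] [TopologicalSpace F]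
  [IsNonarchimedeanLocalField F] {n : ℕ}
  {V : Type*} [AddCommGroup V] [Module ℂ V] {V' : Type*} [AddCommGroup V'] [Module ℂ V']

/-- For `m = 0` the Rankin–Selberg kernel of a Whittaker pair is the constant `W(1) W'(1)`:
`GL_0(F)` is trivial, `diag(1, 1_n) = 1`, `|det 1| ^ (s - n/2) = 1`. [folklore] -/
theorem rsKernel_eq_const_of_rank_zero (hn : 0 < n) {ψ : AddChar F Circle}
    {W : GL (Fin n) F → ℂ} {W' : GL (Fin 0) F → ℂ} (hW : W ∈ whittakerSpace n F ψ)
    (hW' : W' ∈ whittakerSpace 0 F ψ⁻¹) (s : ℂ) :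
    rsKernel hn W W' s = fun _ => W 1 * W' 1 := by
  funext x
  induction x using Quotient.inductionOn' with
  | h g =>
    rw [Subsingleton.elim g 1]
    change rsKernel hn W W' s ((1 : GL (Fin 0) F) : GL (Fin 0) F ⧸ upperUnitriangular (Fin 0) F) = _
    rw [rsKernel_mk_of_mem_whittakerSpace hn hW hW' s 1, rsIntegrand]
    simp

variable [MeasurableSpace (GL (Fin 0) F ⧸ upperUnitriangular (Fin 0) F)]
  (ν : Measure (GL (Fin 0) F ⧸ upperUnitriangular (Fin 0) F))

/-- For `m = 0`: `Ψ(s; W, W') = ν(pt) · W(1) W'(1)` for every `s`. [folklore] -/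
theorem rsZeta_eq_const_of_rank_zero (hn : 0 < n) {ψ : AddChar F Circle}
    {W : GL (Fin n) F → ℂ} {W' : GL (Fin 0) F → ℂ} (hW : W ∈ whittakerSpace n F ψ)
    (hW' : W' ∈ whittakerSpace 0 F ψ⁻¹) (s : ℂ) :
    rsZeta hn ν W W' s = (ν.real Set.univ : ℂ) * (W 1 * W' 1) := by
  rw [rsZeta, rsKernel_eq_const_of_rank_zero hn hW hW' s, integral_const, Complex.real_smul]

-- A measure on the point `GL_0(F) ⧸ U_0` which is positive on open sets and finite on compact sets
-- is finite and non-zero (`IsFiniteMeasure ν`, `NeZero ν` by instance resolution), so the point has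
-- non-zero real mass: Mathlib's `MeasureTheory.measureReal_univ_ne_zero`.
variable [IsFiniteMeasureOnCompacts ν] [ν.IsOpenPosMeasure]

/-- **`HasRSLFactor` in rank `m = 0` with `P = 1`.** For smooth `ψ`-generic `π` on `GL_n(F)`
(`n > 0`), smooth `ψ⁻¹`-generic `π'` on the trivial group `GL_0(F)`, and a measure `ν` giving the
point `GL_0 ⧸ U_0` finite positive mass, the zeta integrals are the constants
`ν(pt) Λ(v) Λ'(v')` (Laurent polynomials of degree `0`), and
`1 = (ν(pt) Λ(v₀) Λ'(v₀'))⁻¹ Ψ(s; W_{v₀}, W'_{v₀'})` for any `Λ(v₀) Λ'(v₀') ≠ 0`; so the fractional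
ideal of the `Ψ`'s is generated by `1 = P(q^{-s})⁻¹`, `P = 1` (Cogdell 2004, Thm. 3.1, degenerate
case). [folklore] -/
theorem hasRSLFactor_one_of_rank_zero (hn : 0 < n) {π : Representation ℂ (GL (Fin n) F) V}
    {π' : Representation ℂ (GL (Fin 0) F) V'} {ψ : AddChar F Circle} (hπ : π.IsSmooth)
    (hπ' : π'.IsSmooth) (hg : IsGeneric π ψ) (hg' : IsGeneric π' ψ⁻¹) :
    HasRSLFactor hn π π' ψ ν 1 := by
  have hL1 : rsLRat 1 = 1 := by rw [rsLRat, map_one, inv_one]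
  refine ⟨by simp, fun Λ hΛ Λ' hΛ' v v' => ?_, ?_⟩
  · -- every zeta integral is the constant `ν(pt) Λ(v) Λ'(v')`
    refine ⟨RatFunc.C ((ν.real Set.univ : ℂ) * (Λ v * Λ' v')),
      ⟨Polynomial.C ((ν.real Set.univ : ℂ) * (Λ v * Λ' v')), 0, ?_⟩, 0, fun s _ => ?_⟩
    · rw [RatFunc.algebraMap_C, pow_zero, div_one]
    · rw [hL1, mul_one, evalAtQ, RatFunc.eval_C, RingHom.id_apply,
        rsZeta_eq_const_of_rank_zero ν hn (whittakerModel_mem hπ hΛ v)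
          (whittakerModel_mem hπ' hΛ' v') s,
        whittakerModel_apply, whittakerModel_apply, map_one, map_one, Module.End.one_apply,
        Module.End.one_apply]
  · -- `1` is a multiple of one zeta integral
    obtain ⟨Λ, hΛ, hΛ0⟩ := (isGeneric_iff π ψ).1 hg
    obtain ⟨Λ', hΛ', hΛ'0⟩ := (isGeneric_iff π' ψ⁻¹).1 hg'
    obtain ⟨v, hv⟩ : ∃ v, Λ v ≠ 0 := by
      by_contra h
      push Not at h
      exact hΛ0 (LinearMap.ext h)
    obtain ⟨v', hv'⟩ : ∃ v', Λ' v' ≠ 0 := by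
      by_contra h
      push Not at h
      exact hΛ'0 (LinearMap.ext h)
    set c : ℂ := (ν.real Set.univ : ℂ) * (Λ v * Λ' v') with hc
    have hc0 : c ≠ 0 :=
      mul_ne_zero (Complex.ofReal_ne_zero.2 measureReal_univ_ne_zero) (mul_ne_zero hv hv')
    refine ⟨1, fun _ => Λ, fun _ => Λ', fun _ => v, fun _ => v', fun _ => RatFunc.C c⁻¹,
      fun _ => hΛ, fun _ => hΛ', fun _ => ⟨Polynomial.C c⁻¹, 0, ?_⟩, 0, fun s _ => ?_⟩
    · rw [RatFunc.algebraMap_C, pow_zero, div_one]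
    · dsimp only
      rw [Fin.sum_univ_one, hL1, evalAtQ, evalAtQ, RatFunc.eval_C, RatFunc.eval_one,
        RingHom.id_apply,
        rsZeta_eq_const_of_rank_zero ν hn (whittakerModel_mem hπ hΛ v)
          (whittakerModel_mem hπ' hΛ' v') s,
        whittakerModel_apply, whittakerModel_apply, map_one, map_one, Module.End.one_apply,
        Module.End.one_apply, ← hc, inv_mul_cancel₀ hc0]

omit [MeasurableSpace (GL (Fin 0) F ⧸ upperUnitriangular (Fin 0) F)]
  [IsFiniteMeasureOnCompacts ν] [ν.IsOpenPosMeasure] in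
/-- A Satake parameter of a representation of `GL_0(F)` is the empty multiset. [folklore] -/
theorem IsSatakeParameter.eq_zero_of_rank_zero {π' : Representation ℂ (GL (Fin 0) F) V'}
    {ϖ : Fˣ} {β : Multiset ℂ} (hβ : IsSatakeParameter π' ϖ β) : β = 0 :=
  Multiset.card_eq_zero.1 hβ.1

omit [ValuativeRel F] [TopologicalSpace F] [IsNonarchimedeanLocalField F]
  [MeasurableSpace (GL (Fin 0) F ⧸ upperUnitriangular (Fin 0) F)]
  [IsFiniteMeasureOnCompacts ν] [ν.IsOpenPosMeasure] in
/-- `satakePairPolynomial α 0 = 1` (empty product). [folklore] -/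
theorem satakePairPolynomial_zero_right (α : Multiset ℂ) : satakePairPolynomial α 0 = 1 := by
  rw [satakePairPolynomial, Multiset.product_zero, Multiset.map_zero, Multiset.prod_zero]

/-- **The unramified computation in rank `m = 0 < n`** at the level of `HasRSLFactor`: for smooth
generic `π`, `π'`, a measure `ν` giving the point `GL_0 ⧸ U_0` finite positive mass, and a Satake
parameter `β` of `π'` (necessarily `β = ∅`), `HasRSLFactor hn π π' ψ ν (satakePairPolynomial α β)`
holds — the product `∏_{i,j} (1 - α_i β_j q^{-s})` is empty and `L = 1`
(`hasRSLFactor_one_of_rank_zero`). [folklore] -/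
theorem hasRSLFactor_satakePairPolynomial_of_rank_zero (hn : 0 < n)
    {π : Representation ℂ (GL (Fin n) F) V} {π' : Representation ℂ (GL (Fin 0) F) V'}
    {ψ : AddChar F Circle} (hπ : π.IsSmooth) (hπ' : π'.IsSmooth) (hg : IsGeneric π ψ)
    (hg' : IsGeneric π' ψ⁻¹) {ϖ : Fˣ} (α : Multiset ℂ) {β : Multiset ℂ}
    (hβ : IsSatakeParameter π' ϖ β) :
    HasRSLFactor hn π π' ψ ν (satakePairPolynomial α β) := by
  rw [hβ.eq_zero_of_rank_zero, satakePairPolynomial_zero_right]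
  exact hasRSLFactor_one_of_rank_zero ν hn hπ hπ' hg hg'

end RankZero

end Literature.NumberTheory.Automorphic
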